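import Literature.AlgebraicGeometry.Frobenioids.BiratSubfunctor
import Literature.AlgebraicGeometry.Frobenioids.CoAngular
import Literature.AlgebraicGeometry.Frobenioids.DivisorMonoidCategoryTheoreticity
import Literature.AlgebraicGeometry.Frobenioids.PreFrobenioidDataOfFunctor
import Literature.AlgebraicGeometry.Frobenioids.Prop53Sub
import HarnessLib

/-!
# Frobenioids I, Corollary 5.4, sub-DAG row C54/L03 `BiratCompat`: an equivalence of Frobenioids
# carrying `(Base, Div, deg_Fr)` carries the rational-function subfunctor `Φ₁^birat` ONTO `Φ₂^birat`

Mochizuki, *The geometry of Frobenioids I: the general theory*, Kyushu J. Math. **62** (2008)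
293–400, §5, Corollary 5.4 (Category-theoreticity of the Realification), kurims text p. 104
ll. 1–6 with proof ll. 21–22: "In light of the definition of the realification [cf. Proposition
5.3], Corollary 5.4 follows immediately from Corollaries 4.10; 4.11, (iii), (iv)"
[cite: MochizukiFrdI2008, Cor. 5.4 p.104]; Proposition 4.4 (iii)/(iv) p. 83 (the subfunctor
`Φ^birat ⊆ Φ^gp` and the description of the endomorphisms of `A^birat` by base-equivalent pairs of
pre-steps) [cite: MochizukiFrdI2008, Prop. 4.4 (iii) p.83].

PROOF-ONLY companion (abc-iut cell, layer L1, sub-DAG `SUBDAG-FrdI-Prop53-Cor54.md` of seat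
abc-iut-w5-d137, row **C54/L03** `FrdI.Cor54Sub.BiratCompat` of `Prop53Sub.lean`; this file: seat
abc-iut-w5-d221).  The row is "INPUT-shaped": `BiratCompat F₁ F₂ ΨBase E` says that the isomorphism of
divisor monoids `E = Ψ^Φ : Φ₁ ⥲ Φ₂` over `Ψ^Base` (the DATA of Cor. 4.11 (iii),
`PreFrobenioidData.DivisorMonoidIsoOverBase`) maps `Φ₁^birat(X)` onto `Φ₂^birat(Ψ^Base X)`, where
`Φ_i^birat = PreFrobenioid.biratSubfunctor F_i` is the CONCRETE rational-function subfunctor of seat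
abc-iut-L1-t5 (`BiratSubfunctor.lean`: the subfunctor of `Φ^gp` generated by the pulled-back
"birational germs" `Φ(δ₁)⁻¹(Div δ₁) − Φ(δ₂)⁻¹(Div δ₂)` of base-equivalent pairs of pre-steps
`δ₁, δ₂ : Y → A`, `δ₁` co-angular — Prop. 4.4 (iv) p. 83).  It cannot hold for an arbitrary `E`; we
prove it in `_of` shape from exactly the printed inputs, taken BY NAME as hypotheses in the typed
shapes of the tree:

* the data `(Ψ^Base, E = Ψ^Φ, η : Base₂ ∘ Ψ ≅ Ψ^Base ∘ Base₁)` of Cor. 4.11 (iii)/(iv) together with the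
  Div-compatibility `Div(Ψ φ) = η_A^* (Ψ^Φ (Div φ))` — the conclusion shape of
  `PreFrobenioidData.Cor411iv` (seat abc-iut-L1-t3, `DivisorMonoidCategoryTheoreticity.lean`), see
  `map_biratSubgroup_eq'`;
* "`Ψ` preserves pre-steps and co-angular pre-steps" for `Ψ` and for `Ψ⁻¹` — the conclusion shape
  `PreservesMor Ψ.functor S₁.IsPreStep S₂.IsPreStep`,
  `PreservesMor Ψ.functor S₁.IsCoAngularPreStep S₂.IsCoAngularPreStep` of `PreFrobenioidData.Thm34ii`
  ([FrdI] Thm. 3.4 (ii)), applied to `Ψ` and to `Ψ.symm`;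
* `C₂ → F_{Φ₂}` a pre-Frobenioid (isomorphisms are isometries: `Φ₂` divisorial, hence sharp).

What is proved (all `theorem`s; no definition, no new `Prop` fact):
* `mapGp_pullGp` — `Ψ^Φ` commutes with pull-backs on `Φ^gp` (naturality of `E` on the groupification);
* `base_map_eq`, `baseEquivalent_map`, `baseEquivalent_inverse_map` — `Base(Ψ φ) = η_Y ∘ Ψ^Base(Base φ) ∘
  η_A⁻¹`, so `Ψ` and `Ψ⁻¹` preserve base-equivalent pairs;
* `invDiv_map` — `Φ(Ψ δ)⁻¹(Div (Ψ δ)) = η_A^* Ψ^Φ (Φ(δ)⁻¹(Div δ))` for a base-isomorphism `δ : Y → A`;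
* `invDiv_conj` — `Φ(ι ∘ δ ∘ κ)⁻¹ Div(ι ∘ δ ∘ κ) = (Base κ⁻¹)^* Φ(δ)⁻¹(Div δ)` for isomorphisms `ι, κ`;
* `mapGp_germ_eq` — `Ψ^Φ` carries the birational germ of `(δ₁, δ₂)` at `A` to the pull-back along `η_A⁻¹`
  of the birational germ of `(Ψ δ₁, Ψ δ₂)` at `Ψ A`;
* `map_biratSubgroup_le` (the inclusion `Ψ^Φ(Φ₁^birat(X)) ⊆ Φ₂^birat(Ψ^Base X)`, for a FUNCTOR `Ψ`),
  `biratSubgroup_le_map` (the reverse inclusion, for an equivalence `Ψ` with `Ψ^Base` full and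
  faithful), `map_biratSubgroup_eq` / `map_biratSubgroup_eq'` (equality), and the slot binding
  `FrdI.Cor54Sub.biratCompat_of : … → BiratCompat F₁ F₂ ΨBase E` — row C54/L03 of the statements file
  `Prop53Sub.lean` (seat abc-iut-w5-d137) CLOSED in `_of` form.
No statement of the paper is strengthened; nothing here bears on [IUTchIII] Cor. 3.12.
-/

namespace Literature.AlgebraicGeometry.Frobenioids

open CategoryTheory Opposite

universe w v₁ v₁' u₁ u₁' v₂ v₂' u₂ u₂'

namespace PreFrobenioid

namespace Cor54Birat

variable {D₁ : Type u₁'} [Category.{v₁'} D₁] {Φ₁ : D₁ᵒᵖ ⥤ CommMonCat.{w}}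
  {C₁ : Type u₁} [Category.{v₁} C₁] {F₁ : C₁ ⥤ ElemFrobenioid Φ₁}
  {D₂ : Type u₂'} [Category.{v₂'} D₂] {Φ₂ : D₂ᵒᵖ ⥤ CommMonCat.{w}}
  {C₂ : Type u₂} [Category.{v₂} C₂] {F₂ : C₂ ⥤ ElemFrobenioid Φ₂}
  {ΨBase : D₁ ⥤ D₂}
  (E : PreFrobenioidData.DivisorMonoidIsoOverBase
    (PreFrobenioidData.ofFunctor Φ₁ F₁) (PreFrobenioidData.ofFunctor Φ₂ F₂) ΨBase)

/-! ### Pull-backs on `Φ`, `Φ^gp` and the isomorphism `Ψ^Φ` -/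

/-- The component `Ψ^Φ_X : Φ₁(X) ⥲ Φ₂(Ψ^Base X)` of the isomorphism of divisor monoids, with its ends typed
in the Def. 1.1 vocabulary `Φ_i.obj (op -)` (definitionally `E.iso X`; the operations package
`PreFrobenioidData.ofFunctor` names the same monoid `(ofFunctor Φ F).Mon X`).
[cite: MochizukiFrdI2008, Cor. 4.11 (iii) p.92] -/
def isoAt (X : D₁) : Φ₁.obj (op X) ≃* Φ₂.obj (op (ΨBase.obj X)) := E.iso X

/-- `isoAt E X` is `E.iso X`. [cite: MochizukiFrdI2008, Cor. 4.11 (iii) p.92] -/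
theorem isoAt_apply (X : D₁) (x : Φ₁.obj (op X)) : isoAt E X x = E.iso X x := rfl

/-- Naturality of `Ψ^Φ` with respect to pull-backs (the field `natural`, read in the Def. 1.1
vocabulary `pull Φ`). [cite: MochizukiFrdI2008, Cor. 4.11 (iii) p.92] -/
theorem iso_pull {X Y : D₁} (f : Y ⟶ X) (x : Φ₁.obj (op X)) :
    isoAt E Y (pull Φ₁ f x) = pull Φ₂ (ΨBase.map f) (isoAt E X x) :=
  E.natural f x

/-- `Φ(g)` on `Φ^gp` extends `Φ(g)` on `Φ` (with `pull` for the transport on `Φ`).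
[cite: MochizukiFrdI2008, Def. 1.1 (ii) p.19] -/
theorem pullGp_of_pull {D : Type*} [Category D] (Φ : Dᵒᵖ ⥤ CommMonCat.{w}) {X Y : D} (g : X ⟶ Y)
    (y : Φ.obj (op Y)) :
    pullGp Φ g (Algebra.GrothendieckGroup.of y) = Algebra.GrothendieckGroup.of (pull Φ g y) :=
  pullGp_of g y

/-- Pulling back along an isomorphism and then along its inverse is the identity on `Φ`.
[cite: MochizukiFrdI2008, Def. 1.1 (ii) p.19] -/
theorem pull_inv_hom {D : Type*} [Category D] (Φ : Dᵒᵖ ⥤ CommMonCat.{w}) {X Y : D} (e : X ≅ Y)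
    (y : Φ.obj (op Y)) : pull Φ e.inv (pull Φ e.hom y) = y := by
  rw [← pull_comp, Iso.inv_hom_id, pull_id]

/-- Naturality of `Ψ^Φ` with respect to pull-backs, extended to `Φ^gp`:
`Ψ^Φ_Y (Φ₁(f) c) = Φ₂(Ψ^Base f) (Ψ^Φ_X c)` for `f : Y → X` and `c ∈ Φ₁(X)^gp`.
[cite: MochizukiFrdI2008, Cor. 4.11 (iii) p.92] -/
theorem mapGp_pullGp {X Y : D₁} (f : Y ⟶ X) (c : Algebra.GrothendieckGroup (Φ₁.obj (op X))) :
    MonGp.map (isoAt E Y).toMonoidHom (pullGp Φ₁ f c) =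
      pullGp Φ₂ (ΨBase.map f) (MonGp.map (isoAt E X).toMonoidHom c) := by
  have key : (MonGp.map (isoAt E Y).toMonoidHom).comp (pullGp Φ₁ f) =
      (pullGp Φ₂ (ΨBase.map f)).comp (MonGp.map (isoAt E X).toMonoidHom) := by
    refine MonGp.hom_ext fun a => ?_
    show MonGp.map (isoAt E Y).toMonoidHom (pullGp Φ₁ f (Algebra.GrothendieckGroup.of a)) =
      pullGp Φ₂ (ΨBase.map f) (MonGp.map (isoAt E X).toMonoidHom (Algebra.GrothendieckGroup.of a))
    rw [pullGp_of_pull, MonGp.map_of, MonGp.map_of, pullGp_of_pull]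
    exact congrArg Algebra.GrothendieckGroup.of (iso_pull E f a)
  exact DFunLike.congr_fun key c

/-! ### `Base(Ψ φ)` through `η`; base-equivalent pairs are preserved -/

section Base

variable {Ψ : C₁ ⥤ C₂} (ηapp : ∀ A : C₁, baseObj F₂ (Ψ.obj A) ≅ ΨBase.obj (baseObj F₁ A))
  (ηnat : ∀ ⦃Y A : C₁⦄ (φ : Y ⟶ A),
    Base F₂ (Ψ.map φ) ≫ (ηapp A).hom = (ηapp Y).hom ≫ ΨBase.map (Base F₁ φ))

include ηnat in
/-- `Base(Ψ φ) = η_Y ∘ Ψ^Base(Base φ) ∘ η_A⁻¹`. [cite: MochizukiFrdI2008, Cor. 4.11 (iv) p.92] -/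
theorem base_map_eq {Y A : C₁} (φ : Y ⟶ A) :
    Base F₂ (Ψ.map φ) = (ηapp Y).hom ≫ ΨBase.map (Base F₁ φ) ≫ (ηapp A).inv := by
  rw [← Category.assoc, ← ηnat φ, Category.assoc, Iso.hom_inv_id, Category.comp_id]

include ηnat in
/-- `Ψ` preserves base-equivalent pairs. [cite: MochizukiFrdI2008, Cor. 5.4 p.104] -/
theorem baseEquivalent_map {Y A : C₁} {δ₁ δ₂ : Y ⟶ A} (h : BaseEquivalent F₁ δ₁ δ₂) :
    BaseEquivalent F₂ (Ψ.map δ₁) (Ψ.map δ₂) := by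
  unfold BaseEquivalent at h ⊢
  rw [base_map_eq ηapp ηnat δ₁, base_map_eq ηapp ηnat δ₂, h]

end Base

/-! ### Transport of `Φ(δ)⁻¹(Div δ)` -/

section InvDiv

variable {Ψ : C₁ ⥤ C₂} (ηapp : ∀ A : C₁, baseObj F₂ (Ψ.obj A) ≅ ΨBase.obj (baseObj F₁ A))
  (ηnat : ∀ ⦃Y A : C₁⦄ (φ : Y ⟶ A),
    Base F₂ (Ψ.map φ) ≫ (ηapp A).hom = (ηapp Y).hom ≫ ΨBase.map (Base F₁ φ))
  (hdiv : ∀ ⦃Y A : C₁⦄ (φ : Y ⟶ A),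
    Div F₂ (Ψ.map φ) = pull Φ₂ (ηapp Y).hom (isoAt E (baseObj F₁ Y) (Div F₁ φ)))

include ηnat hdiv in
/-- For a base-isomorphism `δ : Y → A` of `C₁` with `Ψ δ` a base-isomorphism:
`Φ₂(Ψ δ)⁻¹(Div (Ψ δ)) = η_A^* Ψ^Φ_{Base A}(Φ₁(δ)⁻¹(Div δ))` (Div-compatibility of Cor. 4.11 (iv) and the
naturality of `Ψ^Φ`, `η`). [cite: MochizukiFrdI2008, Cor. 4.11 (iv) p.92] -/
theorem invDiv_map {Y A : C₁} (δ : Y ⟶ A) (h : IsBaseIso F₁ δ) (h' : IsBaseIso F₂ (Ψ.map δ)) :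
    invDiv F₂ (Ψ.map δ) h' = pull Φ₂ (ηapp A).hom (isoAt E (baseObj F₁ A) (invDiv F₁ δ h)) := by
  haveI : IsIso (Base F₁ δ) := h
  haveI : IsIso (Base F₂ (Ψ.map δ)) := h'
  have hsq : inv (Base F₂ (Ψ.map δ)) ≫ (ηapp Y).hom = (ηapp A).hom ≫ ΨBase.map (inv (Base F₁ δ)) := by
    rw [IsIso.inv_comp_eq, ← Category.assoc, ηnat δ, Category.assoc, ← ΨBase.map_comp,
      IsIso.hom_inv_id, ΨBase.map_id, Category.comp_id]
  unfold invDiv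
  rw [hdiv δ, iso_pull E, ← pull_comp, ← pull_comp, hsq]

end InvDiv

/-- In a pre-Frobenioid, conjugating a base-isomorphism `δ : Y → A` by isomorphisms `ι : Y' ⥲ Y`,
`κ : A ⥲ A'` changes `Φ(δ)⁻¹(Div δ)` by the pull-back along `Base(κ⁻¹)`:
`Φ(ι ∘ δ ∘ κ)⁻¹ Div(ι ∘ δ ∘ κ) = Base(κ⁻¹)^* Φ(δ)⁻¹(Div δ)` (isomorphisms are linear isometries,
Remark 1.1.1). [cite: MochizukiFrdI2008, Rem. 1.1.1 p.21] -/
theorem invDiv_conj (hF : IsPreFrobenioid Φ₂ F₂) {Y' Y A A' : C₂} (ι : Y' ⟶ Y) [IsIso ι] (δ : Y ⟶ A)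
    (κ : A ≅ A') (χ : Y' ⟶ A') (hχ : χ = ι ≫ δ ≫ κ.hom) (h : IsBaseIso F₂ δ) (hχ' : IsBaseIso F₂ χ) :
    invDiv F₂ χ hχ' = pull Φ₂ (Base F₂ κ.inv) (invDiv F₂ δ h) := by
  haveI : IsIso (Base F₂ δ) := h
  haveI : IsIso (Base F₂ χ) := hχ'
  subst hχ
  have hι : Div F₂ ι = 1 := isIsometry_of_isIso F₂ hF ι
  have hκ : Div F₂ κ.hom = 1 := isIsometry_of_isIso F₂ hF κ.hom
  have hκl : degFr F₂ κ.hom = 1 := isLinear_of_isIso F₂ κ.hom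
  have hD : Div F₂ (ι ≫ δ ≫ κ.hom) = pull Φ₂ (Base F₂ ι) (Div F₂ δ) := by
    simp only [div_comp, hκ, hκl, hι, map_one, one_pow, mul_one, one_mul, PNat.one_coe, pow_one]
  have hB : inv (Base F₂ (ι ≫ δ ≫ κ.hom)) ≫ Base F₂ ι = Base F₂ κ.inv ≫ inv (Base F₂ δ) := by
    rw [IsIso.inv_comp_eq, base_comp, base_comp, Category.assoc, Category.assoc, ← Category.assoc
      (Base F₂ κ.hom), ← base_comp, Iso.hom_inv_id, base_id, Category.id_comp, IsIso.hom_inv_id,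
      Category.comp_id]
  unfold invDiv
  rw [hD, ← pull_comp, ← pull_comp, hB]

/-! ### Germs go to (pulled-back) germs -/

section Germs

variable {Ψ : C₁ ⥤ C₂} (ηapp : ∀ A : C₁, baseObj F₂ (Ψ.obj A) ≅ ΨBase.obj (baseObj F₁ A))
  (ηnat : ∀ ⦃Y A : C₁⦄ (φ : Y ⟶ A),
    Base F₂ (Ψ.map φ) ≫ (ηapp A).hom = (ηapp Y).hom ≫ ΨBase.map (Base F₁ φ))
  (hdiv : ∀ ⦃Y A : C₁⦄ (φ : Y ⟶ A),
    Div F₂ (Ψ.map φ) = pull Φ₂ (ηapp Y).hom (isoAt E (baseObj F₁ Y) (Div F₁ φ)))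
  (hpre : PreFrobenioidData.PreservesMor Ψ (PreFrobenioidData.ofFunctor Φ₁ F₁).IsPreStep
    (PreFrobenioidData.ofFunctor Φ₂ F₂).IsPreStep)
  (hco : PreFrobenioidData.PreservesMor Ψ (PreFrobenioidData.ofFunctor Φ₁ F₁).IsCoAngularPreStep
    (PreFrobenioidData.ofFunctor Φ₂ F₂).IsCoAngularPreStep)

include hpre in
/-- `Ψ` preserves pre-steps (the hypothesis, read in the Def. 1.2 vocabulary).
[cite: MochizukiFrdI2008, Thm. 3.4 (ii) p.62] -/
theorem isPreStep_map {Y A : C₁} {δ : Y ⟶ A} (h : IsPreStep F₁ δ) : IsPreStep F₂ (Ψ.map δ) :=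
  (PreFrobenioidData.ofFunctor_isPreStep F₂ _).1
    (hpre δ ((PreFrobenioidData.ofFunctor_isPreStep F₁ _).2 h))

include hco in
/-- `Ψ` preserves co-angular pre-steps (the hypothesis, read in the Def. 1.2 vocabulary).
[cite: MochizukiFrdI2008, Thm. 3.4 (ii) p.62] -/
theorem isCoAngularPreStep_map {Y A : C₁} {δ : Y ⟶ A} (h : IsCoAngularPreStep F₁ δ) :
    IsCoAngularPreStep F₂ (Ψ.map δ) := by
  have h₁ : (PreFrobenioidData.ofFunctor Φ₁ F₁).IsCoAngularPreStep δ :=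
    ⟨(PreFrobenioidData.ofFunctor_isCoAngular F₁ δ).2 h.1,
      (PreFrobenioidData.ofFunctor_isPreStep F₁ δ).2 h.2⟩
  have h₂ := hco δ h₁
  exact ⟨(PreFrobenioidData.ofFunctor_isCoAngular F₂ _).1 h₂.1,
    (PreFrobenioidData.ofFunctor_isPreStep F₂ _).1 h₂.2⟩

include ηnat hdiv in
/-- **`Ψ^Φ` carries germs to pulled-back germs**: for base-isomorphisms `δ₁, δ₂ : Y → A` of `C₁` whose
images `Ψ δ₁, Ψ δ₂` are base-isomorphisms,
`Ψ^Φ_{Base A}(Φ(δ₁)⁻¹(Div δ₁) − Φ(δ₂)⁻¹(Div δ₂)) = (η_A⁻¹)^* (Φ(Ψδ₁)⁻¹(Div Ψδ₁) − Φ(Ψδ₂)⁻¹(Div Ψδ₂))`.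
[cite: MochizukiFrdI2008, Cor. 5.4 p.104] -/
theorem mapGp_germ_eq {Y A : C₁} (δ₁ δ₂ : Y ⟶ A) (h₁ : IsBaseIso F₁ δ₁) (h₂ : IsBaseIso F₁ δ₂)
    (h₁' : IsBaseIso F₂ (Ψ.map δ₁)) (h₂' : IsBaseIso F₂ (Ψ.map δ₂)) :
    MonGp.map (isoAt E (baseObj F₁ A)).toMonoidHom
        (Algebra.GrothendieckGroup.of (invDiv F₁ δ₁ h₁) / Algebra.GrothendieckGroup.of (invDiv F₁ δ₂ h₂)) =
      pullGp Φ₂ (ηapp A).inv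
        (Algebra.GrothendieckGroup.of (invDiv F₂ (Ψ.map δ₁) h₁') /
          Algebra.GrothendieckGroup.of (invDiv F₂ (Ψ.map δ₂) h₂')) := by
  rw [map_div, map_div, MonGp.map_of, MonGp.map_of, pullGp_of_pull, pullGp_of_pull,
    invDiv_map E ηapp ηnat hdiv δ₁ h₁ h₁', invDiv_map E ηapp ηnat hdiv δ₂ h₂ h₂',
    pull_inv_hom, pull_inv_hom]
  rfl

include ηnat hdiv hpre hco in
/-- **`Ψ^Φ` carries germs to pulled-back germs**: for a birational germ `d` at `A ∈ Ob(C₁)`,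
`Ψ^Φ_{Base A}(d) = (η_A⁻¹)^* d'` for a birational germ `d'` at `Ψ A` — by Thm. 3.4 (ii) `Ψ δ₁` is a
co-angular pre-step, `Ψ δ₂` a pre-step, and they are base-equivalent.
[cite: MochizukiFrdI2008, Cor. 5.4 p.104] -/
theorem mapGp_germ {A : C₁} {d : Algebra.GrothendieckGroup (Φ₁.obj (op (baseObj F₁ A)))}
    (hd : d ∈ biratGerms F₁ A) :
    ∃ d' ∈ biratGerms F₂ (Ψ.obj A),
      MonGp.map (isoAt E (baseObj F₁ A)).toMonoidHom d = pullGp Φ₂ (ηapp A).inv d' := by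
  obtain ⟨Y, δ₁, δ₂, h₁, h₂, hb, rfl⟩ := hd
  have h₁' : IsCoAngularPreStep F₂ (Ψ.map δ₁) := isCoAngularPreStep_map hco h₁
  have h₂' : IsPreStep F₂ (Ψ.map δ₂) := isPreStep_map hpre h₂
  exact ⟨_, ⟨Ψ.obj Y, Ψ.map δ₁, Ψ.map δ₂, h₁', h₂', baseEquivalent_map ηapp ηnat hb, rfl⟩,
    mapGp_germ_eq E ηapp ηnat hdiv δ₁ δ₂ h₁.2.2 h₂.2 h₁'.2.2 h₂'.2⟩

include ηnat hdiv hpre hco in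
/-- **Row C54/L03, the inclusion `Ψ^Φ(Φ₁^birat(X)) ⊆ Φ₂^birat(Ψ^Base X)`** (for any functor `Ψ` carrying
`(Base, Div)` as in Cor. 4.11 (iv) and preserving (co-angular) pre-steps as in Thm. 3.4 (ii)): a generator
`Φ₁(f)(d)`, `f : X → Base A`, `d` a germ at `A`, goes to the generator `Φ₂(Ψ^Base f ∘ η_A⁻¹)(d')`, `d'`
a germ at `Ψ A`. [cite: MochizukiFrdI2008, Cor. 5.4 p.104] -/
theorem map_biratSubgroup_le (X : D₁) :
    ((biratSubfunctor F₁).carrier X).map (MonGp.map (isoAt E X).toMonoidHom) ≤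
      (biratSubfunctor F₂).carrier (ΨBase.obj X) := by
  rw [biratSubfunctor_carrier, biratSubfunctor_carrier, MonoidHom.map_closure, Subgroup.closure_le]
  rintro _ ⟨c, ⟨A, f, d, hd, rfl⟩, rfl⟩
  obtain ⟨d', hd', hE⟩ := mapGp_germ E ηapp ηnat hdiv hpre hco hd
  refine Subgroup.subset_closure ⟨Ψ.obj A, ΨBase.map f ≫ (ηapp A).inv, d', hd', ?_⟩
  rw [mapGp_pullGp E f d, hE, ← pullGp_comp]

end Germs

/-! ### The reverse inclusion, for an equivalence `Ψ` -/

section Equivalence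

variable (Ψ : C₁ ≌ C₂) (ηapp : ∀ A : C₁, baseObj F₂ (Ψ.functor.obj A) ≅ ΨBase.obj (baseObj F₁ A))
  (ηnat : ∀ ⦃Y A : C₁⦄ (φ : Y ⟶ A),
    Base F₂ (Ψ.functor.map φ) ≫ (ηapp A).hom = (ηapp Y).hom ≫ ΨBase.map (Base F₁ φ))
  (hdiv : ∀ ⦃Y A : C₁⦄ (φ : Y ⟶ A),
    Div F₂ (Ψ.functor.map φ) = pull Φ₂ (ηapp Y).hom (isoAt E (baseObj F₁ Y) (Div F₁ φ)))
  (hpre : PreFrobenioidData.PreservesMor Ψ.functor (PreFrobenioidData.ofFunctor Φ₁ F₁).IsPreStep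
    (PreFrobenioidData.ofFunctor Φ₂ F₂).IsPreStep)
  (hco : PreFrobenioidData.PreservesMor Ψ.functor (PreFrobenioidData.ofFunctor Φ₁ F₁).IsCoAngularPreStep
    (PreFrobenioidData.ofFunctor Φ₂ F₂).IsCoAngularPreStep)
  (hpre' : PreFrobenioidData.PreservesMor Ψ.inverse (PreFrobenioidData.ofFunctor Φ₂ F₂).IsPreStep
    (PreFrobenioidData.ofFunctor Φ₁ F₁).IsPreStep)
  (hco' : PreFrobenioidData.PreservesMor Ψ.inverse (PreFrobenioidData.ofFunctor Φ₂ F₂).IsCoAngularPreStep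
    (PreFrobenioidData.ofFunctor Φ₁ F₁).IsCoAngularPreStep)
  (hF₂ : IsPreFrobenioid Φ₂ F₂)

/-- The counit of `Ψ` at `X'`, as an isomorphism `Ψ Ψ⁻¹ X' ⥲ X'` with plainly typed ends. [folklore] -/
def counitAt (X' : C₂) : Ψ.functor.obj (Ψ.inverse.obj X') ≅ X' := Ψ.counitIso.app X'

/-- `Ψ Ψ⁻¹ δ' = ε ∘ δ' ∘ ε⁻¹` for the counit `ε` (`Equivalence.fun_inv_map`). [folklore] -/
private theorem fun_inv_map_eq {Y' A' : C₂} (δ' : Y' ⟶ A') :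
    Ψ.functor.map (Ψ.inverse.map δ') = (counitAt Ψ Y').hom ≫ δ' ≫ (counitAt Ψ A').inv :=
  Ψ.fun_inv_map _ _ δ'

include ηnat in
/-- `Ψ⁻¹` preserves base-equivalent pairs (through `η`, the counit `Ψ Ψ⁻¹ ≅ 1` and the faithfulness of
`Ψ^Base`). [cite: MochizukiFrdI2008, Cor. 5.4 p.104] -/
theorem baseEquivalent_inverse_map [ΨBase.Faithful] {Y' A' : C₂} {δ₁ δ₂ : Y' ⟶ A'}
    (h : BaseEquivalent F₂ δ₁ δ₂) :
    BaseEquivalent F₁ (Ψ.inverse.map δ₁) (Ψ.inverse.map δ₂) := by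
  unfold BaseEquivalent at h ⊢
  apply ΨBase.map_injective
  have key : ∀ δ : Y' ⟶ A', ΨBase.map (Base F₁ (Ψ.inverse.map δ)) =
      (ηapp (Ψ.inverse.obj Y')).inv ≫
        ((Base F₂ (counitAt Ψ Y').hom ≫ Base F₂ δ ≫ Base F₂ (counitAt Ψ A').inv) ≫
          (ηapp (Ψ.inverse.obj A')).hom) := by
    intro δ
    have h1 := ηnat (Ψ.inverse.map δ)
    rw [fun_inv_map_eq Ψ δ, base_comp, base_comp] at h1
    exact (Iso.eq_inv_comp _).2 h1.symm
  rw [key, key, h]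

include ηnat hdiv hpre hpre' hco' hF₂ in
/-- **Row C54/L03, the inclusion `Φ₂^birat(Ψ^Base X) ⊆ Ψ^Φ(Φ₁^birat(X))`** for an EQUIVALENCE `Ψ` with
`Ψ^Base` full and faithful (Cor. 4.11 (ii)): a generator `Φ₂(g)(d')`, `g : Ψ^Base X → Base A'`, `d'` the
germ of a base-equivalent pair `δ₁', δ₂' : Y' → A'`, is `Ψ^Φ_X(Φ₁(f)(d))` for the germ `d` of
`(Ψ⁻¹δ₁', Ψ⁻¹δ₂')` at `Ψ⁻¹A'` (Thm. 3.4 (ii) for `Ψ⁻¹`) and the `Ψ^Base`-preimage `f` of `g` corrected by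
the isomorphisms `η`, `Base(Ψ Ψ⁻¹ A' ⥲ A')` (conjugation by the counit changes the germ by a pull-back
along an isomorphism, `invDiv_conj`). [cite: MochizukiFrdI2008, Cor. 5.4 p.104] -/
theorem biratSubgroup_le_map [ΨBase.Full] [ΨBase.Faithful] (X : D₁) :
    (biratSubfunctor F₂).carrier (ΨBase.obj X) ≤
      ((biratSubfunctor F₁).carrier X).map (MonGp.map (isoAt E X).toMonoidHom) := by
  rw [biratSubfunctor_carrier, biratSubfunctor_carrier, Subgroup.closure_le]
  rintro _ ⟨A', g, d', ⟨Y', δ₁', δ₂', h₁', h₂', hb', rfl⟩, rfl⟩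
  -- the pair pulled back to `C₁` along `Ψ⁻¹`, and its germ at `A := Ψ⁻¹ A'`
  have h₁ : IsCoAngularPreStep F₁ (Ψ.inverse.map δ₁') := by
    have h := hco' δ₁' ⟨(PreFrobenioidData.ofFunctor_isCoAngular F₂ δ₁').2 h₁'.1,
      (PreFrobenioidData.ofFunctor_isPreStep F₂ δ₁').2 h₁'.2⟩
    exact ⟨(PreFrobenioidData.ofFunctor_isCoAngular F₁ _).1 h.1,
      (PreFrobenioidData.ofFunctor_isPreStep F₁ _).1 h.2⟩
  have h₂ : IsPreStep F₁ (Ψ.inverse.map δ₂') :=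
    (PreFrobenioidData.ofFunctor_isPreStep F₁ _).1
      (hpre' δ₂' ((PreFrobenioidData.ofFunctor_isPreStep F₂ δ₂').2 h₂'))
  have hgerm : Algebra.GrothendieckGroup.of (invDiv F₁ (Ψ.inverse.map δ₁') h₁.2.2) /
      Algebra.GrothendieckGroup.of (invDiv F₁ (Ψ.inverse.map δ₂') h₂.2) ∈
        biratGerms F₁ (Ψ.inverse.obj A') :=
    ⟨Ψ.inverse.obj Y', _, _, h₁, h₂, baseEquivalent_inverse_map Ψ ηapp ηnat hb', rfl⟩
  -- `Ψ^Φ_{Base A}` of that germ is the pull-back of the germ `d'` along the isomorphism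
  -- `ρ := η_A⁻¹ ≫ Base(ε_{A'}) : Ψ^Base(Base A) ⥲ Base A'`
  have h₁'' : IsPreStep F₂ (Ψ.functor.map (Ψ.inverse.map δ₁')) := isPreStep_map hpre h₁.2
  have h₂'' : IsPreStep F₂ (Ψ.functor.map (Ψ.inverse.map δ₂')) := isPreStep_map hpre h₂
  have hconj : ∀ (δ' : Y' ⟶ A') (hδ' : IsBaseIso F₂ δ')
      (hΨ : IsBaseIso F₂ (Ψ.functor.map (Ψ.inverse.map δ'))),
      invDiv F₂ (Ψ.functor.map (Ψ.inverse.map δ')) hΨ =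
        pull Φ₂ (Base F₂ (counitAt Ψ A').hom) (invDiv F₂ δ' hδ') :=
    fun δ' hδ' hΨ =>
      invDiv_conj hF₂ (counitAt Ψ Y').hom δ' (counitAt Ψ A').symm _ (fun_inv_map_eq Ψ δ') hδ' hΨ
  have hE : MonGp.map (isoAt E (baseObj F₁ (Ψ.inverse.obj A'))).toMonoidHom
      (Algebra.GrothendieckGroup.of (invDiv F₁ (Ψ.inverse.map δ₁') h₁.2.2) /
        Algebra.GrothendieckGroup.of (invDiv F₁ (Ψ.inverse.map δ₂') h₂.2)) =
      pullGp Φ₂ ((ηapp (Ψ.inverse.obj A')).inv ≫ Base F₂ (counitAt Ψ A').hom)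
        (Algebra.GrothendieckGroup.of (invDiv F₂ δ₁' h₁'.2.2) /
          Algebra.GrothendieckGroup.of (invDiv F₂ δ₂' h₂'.2)) := by
    rw [mapGp_germ_eq E ηapp ηnat hdiv _ _ h₁.2.2 h₂.2 h₁''.2 h₂''.2, hconj δ₁' h₁'.2.2 h₁''.2,
      hconj δ₂' h₂'.2 h₂''.2, ← pullGp_of_pull, ← pullGp_of_pull, ← map_div, ← pullGp_comp]
  -- the preimage `f` of `g ≫ ρ⁻¹` under the full functor `Ψ^Base`
  haveI : IsIso (Base F₂ (counitAt Ψ A').hom) := isBaseIso_of_isIso F₂ _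
  refine ⟨pullGp Φ₁
      (ΨBase.preimage (g ≫ inv ((ηapp (Ψ.inverse.obj A')).inv ≫ Base F₂ (counitAt Ψ A').hom)))
      (Algebra.GrothendieckGroup.of (invDiv F₁ (Ψ.inverse.map δ₁') h₁.2.2) /
        Algebra.GrothendieckGroup.of (invDiv F₁ (Ψ.inverse.map δ₂') h₂.2)),
    Subgroup.subset_closure ⟨Ψ.inverse.obj A', _, _, hgerm, rfl⟩, ?_⟩
  rw [mapGp_pullGp E, hE, ← pullGp_comp, ΨBase.map_preimage, Category.assoc, IsIso.inv_hom_id,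
    Category.comp_id]

include ηnat hdiv hpre hco hpre' hco' hF₂ in
/-- **Row C54/L03 `BiratCompat`** in its literal shape: `Ψ^Φ_X(Φ₁^birat(X)) = Φ₂^birat(Ψ^Base X)` for every
`X ∈ Ob(D₁)`, for an equivalence of Frobenioids `Ψ` carrying `(Base, Div)` through `(Ψ^Base, Ψ^Φ, η)`
(Cor. 4.11 (iii)/(iv)) and preserving (co-angular) pre-steps in both directions (Thm. 3.4 (ii)), `Ψ^Base`
full and faithful (Cor. 4.11 (ii)), `C₂` a pre-Frobenioid — componentwise form of the data.
[cite: MochizukiFrdI2008, Cor. 5.4 p.104] -/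
theorem map_biratSubgroup_eq [ΨBase.Full] [ΨBase.Faithful] (X : D₁) :
    ((biratSubfunctor F₁).carrier X).map (MonGp.map (isoAt E X).toMonoidHom) =
      (biratSubfunctor F₂).carrier (ΨBase.obj X) :=
  le_antisymm (map_biratSubgroup_le E ηapp ηnat hdiv hpre hco X)
    (biratSubgroup_le_map E Ψ ηapp ηnat hdiv hpre hpre' hco' hF₂ X)

end Equivalence

/-! ### The same, with the data in the packaged shape of Cor. 4.11 (iv) -/

/-- **Row C54/L03 `BiratCompat`**, data in the shape of `PreFrobenioidData.Cor411iv`: for an equivalence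
of Frobenioids `Ψ : C₁ ⥲ C₂`, a full and faithful `Ψ^Base`, the isomorphism `E = Ψ^Φ` over it, an
isomorphism of functors `η : Base₂ ∘ Ψ ≅ Ψ^Base ∘ Base₁` with `Div(Ψ φ) = η_A^* Ψ^Φ(Div φ)`, and `Ψ`, `Ψ⁻¹`
preserving pre-steps and co-angular pre-steps (Thm. 3.4 (ii)), with `C₂ → F_{Φ₂}` a pre-Frobenioid:
`Ψ^Φ_X(Φ₁^birat(X)) = Φ₂^birat(Ψ^Base X)` for every `X`. [cite: MochizukiFrdI2008, Cor. 5.4 p.104] -/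
theorem map_biratSubgroup_eq' (Ψ : C₁ ≌ C₂) [ΨBase.Full] [ΨBase.Faithful]
    (η : Ψ.functor ⋙ (PreFrobenioidData.ofFunctor Φ₂ F₂).base ≅
      (PreFrobenioidData.ofFunctor Φ₁ F₁).base ⋙ ΨBase)
    (hdiv : ∀ ⦃A B : C₁⦄ (φ : A ⟶ B),
      (PreFrobenioidData.ofFunctor Φ₂ F₂).div (Ψ.functor.map φ) =
        (PreFrobenioidData.ofFunctor Φ₂ F₂).pull (η.hom.app A)
          (E.iso ((PreFrobenioidData.ofFunctor Φ₁ F₁).base.obj A)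
            ((PreFrobenioidData.ofFunctor Φ₁ F₁).div φ)))
    (hpre : PreFrobenioidData.PreservesMor Ψ.functor (PreFrobenioidData.ofFunctor Φ₁ F₁).IsPreStep
      (PreFrobenioidData.ofFunctor Φ₂ F₂).IsPreStep)
    (hco : PreFrobenioidData.PreservesMor Ψ.functor
      (PreFrobenioidData.ofFunctor Φ₁ F₁).IsCoAngularPreStep
      (PreFrobenioidData.ofFunctor Φ₂ F₂).IsCoAngularPreStep)
    (hpre' : PreFrobenioidData.PreservesMor Ψ.inverse (PreFrobenioidData.ofFunctor Φ₂ F₂).IsPreStep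
      (PreFrobenioidData.ofFunctor Φ₁ F₁).IsPreStep)
    (hco' : PreFrobenioidData.PreservesMor Ψ.inverse
      (PreFrobenioidData.ofFunctor Φ₂ F₂).IsCoAngularPreStep
      (PreFrobenioidData.ofFunctor Φ₁ F₁).IsCoAngularPreStep)
    (hF₂ : IsPreFrobenioid Φ₂ F₂) (X : D₁) :
    ((biratSubfunctor F₁).carrier X).map (MonGp.map (E.iso X).toMonoidHom) =
      (biratSubfunctor F₂).carrier (ΨBase.obj X) :=
  map_biratSubgroup_eq E Ψ (fun A => η.app A) (fun _ _ φ => η.hom.naturality φ) (fun _ _ φ => hdiv φ)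
    hpre hco hpre' hco' hF₂ X

end Cor54Birat

end PreFrobenioid

/-! ### The slot of the statements file -/

namespace FrdI.Cor54Sub

variable {D₁ : Type u₁'} [Category.{v₁'} D₁] {Φ₁ : D₁ᵒᵖ ⥤ CommMonCat.{w}}
  {C₁ : Type u₁} [Category.{v₁} C₁] (F₁ : C₁ ⥤ ElemFrobenioid Φ₁)
  {D₂ : Type u₂'} [Category.{v₂'} D₂] {Φ₂ : D₂ᵒᵖ ⥤ CommMonCat.{w}}
  {C₂ : Type u₂} [Category.{v₂} C₂] (F₂ : C₂ ⥤ ElemFrobenioid Φ₂)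

/-- **Row C54/L03 `FrdI.Cor54Sub.BiratCompat` CLOSED in `_of` form**: for an equivalence of Frobenioids
`Ψ : C₁ ⥲ C₂` with `C₂ → F_{Φ₂}` a pre-Frobenioid, a full and faithful `Ψ^Base` (Cor. 4.11 (ii)), the
isomorphism of divisor monoids `E = Ψ^Φ` over `Ψ^Base` and `η : Base₂ ∘ Ψ ≅ Ψ^Base ∘ Base₁` with the
Div-compatibility of Cor. 4.11 (iv) (VERBATIM the conclusion shape of `PreFrobenioidData.Cor411iv`), and
`Ψ`, `Ψ⁻¹` preserving pre-steps and co-angular pre-steps (VERBATIM the conclusion shape of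
`PreFrobenioidData.Thm34ii`, [FrdI] Thm. 3.4 (ii), for `Ψ` and `Ψ.symm`): `Ψ^Φ` carries `Φ₁^birat(X)` ONTO
`Φ₂^birat(Ψ^Base X)` for every `X` — "Corollary 5.4 follows immediately from Corollaries 4.10; 4.11, (iii),
(iv)" (p. 104 l. 21), the `Φ^birat`-part. [cite: MochizukiFrdI2008, Cor. 5.4 p.104] -/
theorem biratCompat_of (Ψ : C₁ ≌ C₂) (hF₂ : IsPreFrobenioid Φ₂ F₂) (ΨBase : D₁ ⥤ D₂)
    [ΨBase.Full] [ΨBase.Faithful]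
    (E : PreFrobenioidData.DivisorMonoidIsoOverBase
      (PreFrobenioidData.ofFunctor Φ₁ F₁) (PreFrobenioidData.ofFunctor Φ₂ F₂) ΨBase)
    (η : Ψ.functor ⋙ (PreFrobenioidData.ofFunctor Φ₂ F₂).base ≅
      (PreFrobenioidData.ofFunctor Φ₁ F₁).base ⋙ ΨBase)
    (hdiv : ∀ ⦃A B : C₁⦄ (φ : A ⟶ B),
      (PreFrobenioidData.ofFunctor Φ₂ F₂).div (Ψ.functor.map φ) =
        (PreFrobenioidData.ofFunctor Φ₂ F₂).pull (η.hom.app A)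
          (E.iso ((PreFrobenioidData.ofFunctor Φ₁ F₁).base.obj A)
            ((PreFrobenioidData.ofFunctor Φ₁ F₁).div φ)))
    (hpre : PreFrobenioidData.PreservesMor Ψ.functor (PreFrobenioidData.ofFunctor Φ₁ F₁).IsPreStep
      (PreFrobenioidData.ofFunctor Φ₂ F₂).IsPreStep)
    (hco : PreFrobenioidData.PreservesMor Ψ.functor
      (PreFrobenioidData.ofFunctor Φ₁ F₁).IsCoAngularPreStep
      (PreFrobenioidData.ofFunctor Φ₂ F₂).IsCoAngularPreStep)
    (hpre' : PreFrobenioidData.PreservesMor Ψ.inverse (PreFrobenioidData.ofFunctor Φ₂ F₂).IsPreStep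
      (PreFrobenioidData.ofFunctor Φ₁ F₁).IsPreStep)
    (hco' : PreFrobenioidData.PreservesMor Ψ.inverse
      (PreFrobenioidData.ofFunctor Φ₂ F₂).IsCoAngularPreStep
      (PreFrobenioidData.ofFunctor Φ₁ F₁).IsCoAngularPreStep) :
    BiratCompat F₁ F₂ ΨBase E :=
  fun X => PreFrobenioid.Cor54Birat.map_biratSubgroup_eq' E Ψ η hdiv hpre hco hpre' hco' hF₂ X

end FrdI.Cor54Sub

end Literature.AlgebraicGeometry.Frobenioids
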